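import Literature.NumberTheory.PAdicHodge.BdRBaseChangeFiltered
import Literature.NumberTheory.PAdicHodge.BaseGaloisAction
import Literature.NumberTheory.GaloisRepresentations.OuterGaloisConjugation
import HarnessLib

/-!
# `B_dR(F) ≃ B_dR(F)` along an OUTER Galois automorphism: `ĝ ∈ Aut(F̄/ℚ_ℓ)` with `ĝ(F) = F` acts on `B_dR(F)`,
# filtered, `θ`-compatibly, `g`-semilinearly, intertwining `Γ_F` through `σ ↦ ĝ σ ĝ⁻¹`

Topic `NumberTheory/PAdicHodge`; theorems only (no definition, no named fact, no instance, no `sorry`). Companion of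
`BdRBaseChangeFiltered` (`exists_fracBdR_ringEquiv_filtered`: `B_dR(K) ≃ B_dR(L)` along a continuous embedding `K → L`,
equivariant for `res = absGaloisRestrict K L`) and of `BaseGaloisAction` (the Galois group `G₀` of `F̄` over `ℚ_ℓ` acts on
`ℂ_F` by isometries). Brinon–Conrad p. 80: "the construction of `B_dR⁺` … only depends on `𝒪_{ℂ_K}` endowed with its
`G_K`-action"; here the SAME functoriality is run along an automorphism of `𝒪_{ℂ_F}` which is NOT `Γ_F`-equivariant but
intertwines `Γ_F` with its outer conjugate.

Setting (`GaloisRepresentations/OuterGaloisConjugation`): `F` an `ℓ`-adic field, `g` an automorphism of `F` (over some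
subfield `K₀`), `ĝ : F̄ ≃ₐ[K₀] F̄` a lift (`ĝ ∘ (F → F̄) = (F → F̄) ∘ g`), `α : Γ_F ≃ₜ* Γ_F` the outer conjugation (`α σ • ĝ x = ĝ (σ • x)`).

* §1 `exists_baseGaloisGroup_outer` — `ĝ` IS an element of `G₀ = Gal(F̄/ℚ_ℓ)` (rigidity of `ℚ_ℓ → F`, `LocalField.ringHom_padic_ext`);
  `exists_completedAlgClosure_ringEquiv_outer` — `ĝ` extends to an isometric ring automorphism `e` of `ℂ_F` with
  `e (σ • x) = α σ • e x` (`BaseGaloisAction`: `G₀` acts on `ℂ_F` by isometries).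
* §2 `bdRPlusMap_galBdRPlus_pair` — `B_dR⁺(f) ∘ galBdRPlus σ = galBdRPlus σ' ∘ B_dR⁺(f)` whenever `f ∘ galInt σ = galInt σ' ∘ f`
  (the pair version of `bdRPlusMap_galBdRPlus`).
* §3 `ringEquiv_embBdRHom_outer`, `ringEquiv_algClosureToBdR_outer` — `B_dR⁺(e|_{𝒪}) ∘ (F → B_dR⁺) = (F → B_dR⁺) ∘ g` and
  `B_dR⁺(e|_{𝒪}) ∘ ι_F = ι_F ∘ ĝ` on Fontaine's section `ι_F : F̄ → B_dR⁺(F)` (Hensel uniqueness, as in `BdRBaseChangeFiltered`).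
* §4 ★ `exists_fracBdR_ringEquiv_outer` — **there is a ring automorphism `Φ` of `B_dR(F) = Frac B_dR⁺(F)` with
  `Φ (σ • b) = α σ • Φ b`, `Φ|_{ℚ_ℓ} = id`, `Φ ∘ ι_F = ι_F ∘ ĝ`, `Φ|_F = g`, and `b ∈ Fil^i ↔ Φ b ∈ Fil^i`.**

Use (crux K★ `stmt-BirchSwinnertonDyer-22226`, G5 by Galois descent): with the abstract transport of Kato's `exp*`
(`Summits/…/KimAtThreeDeepLowerExpStarOmegaTransport`) this gives the `Gal(F/F₀)`-equivariance of `exp*_ω` on `H¹(F, V_pE)`.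
BSD / K★ are not proved by this file.

## References
* O. Brinon, B. Conrad, *CMI Summer School notes on p-adic Hodge theory* (2009), p. 80 and Prop. 6.3.8. [BrinonConrad2009]
* J.-M. Fontaine, *Le corps des périodes p-adiques*, Astérisque 223 (1994), Exp. II §1.2, §1.5. [FontaineAsterisque223III]
* J. Tate, *p-divisible groups* (1967), §3.1 (`Gal(K̄/ℚ_p)` acting on `C`). [Tate1967]
-/

noncomputable section

open Field ValuativeRel Ideal WittVector Polynomial
open Literature.AlgebraicGeometry.Resolution

namespace Literature.NumberTheory.PAdicHodge

open Literature.NumberTheory.GaloisRepresentations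
open Literature.NumberTheory.GaloisRepresentations.IsNonarchimedeanLocalField

section Pair

variable {F : Type} [Field F] [ValuativeRel F] [TopologicalSpace F] [IsNonarchimedeanLocalField F] [CharZero F]
  {ℓ : ℕ} [Fact ℓ.Prime] [Fact (¬ IsUnit ((ℓ : ℕ) : integerC F))] [IsAdicComplete (Ideal.span {((ℓ : ℕ) : integerC F)}) (integerC F)]
  (hF : valuation F (ℓ : F) < 1)

/-! ### §2 (pair) Equivariance of `B_dR⁺(f)` for a compatible pair -/

/-- **`B_dR⁺(f)` intertwines `galBdRPlus σ` and `galBdRPlus σ'` whenever `f ∘ galInt σ = galInt σ' ∘ f`** (functoriality of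
`B_dR⁺`, `galBdRPlus σ = B_dR⁺(galInt σ)`; the pair version of `bdRPlusMap_galBdRPlus`). [cite: BrinonConrad2009, Prop. 6.3.8] -/
theorem bdRPlusMap_galBdRPlus_pair (f : integerC F →+* integerC F) (σ σ' : absoluteGaloisGroup F)
    (hf : ∀ x : integerC F, f (galInt σ x) = galInt σ' (f x)) (b : BDeRhamPlus (integerC F) ℓ) :
    adicCompletionMap _ _ _ (map_ker_fontaineThetaInvertP_le ℓ f) (galBdRPlus σ b) =
      galBdRPlus σ' (adicCompletionMap _ _ _ (map_ker_fontaineThetaInvertP_le ℓ f) b) :=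
  ((bdRPlusMap_comp_apply (galInt σ) f b).trans (bdRPlusMap_congr (RingHom.ext fun x => hf x) b)).trans
    (bdRPlusMap_comp_apply f (galInt σ') b).symm

/-! ### §3 (pair) Compatibility with `F ⊆ B_dR⁺(F)` and `F̄ ⊆ B_dR⁺(F)` -/

/-- **`Φp` extends `g` on `F ⊆ B_dR⁺(F)`**: `Φp (x̃) = (g x)~` for the Hensel embedding `embBdRHom : F → B_dR⁺(F)`, when `Φp = B_dR⁺(f)`
for the restriction `f` of a ring endomorphism `e` of `ℂ_F` extending `g` — both `Φp ∘ embBdRHom` and `embBdRHom ∘ g` are ring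
maps `F → B_dR⁺(F)` agreeing on `ℚ_ℓ` and sending a primitive element of `F/ℚ_ℓ` to roots of its minimal polynomial with the same
image under `θ`, hence equal (`root_unique`). [cite: FontaineAsterisque223III, Exp. II §1.5] [cite: BrinonConrad2009, Prop. 6.3.8] -/
theorem ringEquiv_embBdRHom_outer (hFF : Function.Surjective (fontaineTheta (integerC F) ℓ)) (g : F ≃+* F)
    (f : integerC F →+* integerC F) (e : CompletedAlgClosure F →+* CompletedAlgClosure F)
    (hfe : ∀ x : integerC F, ((f x : integerC F) : CompletedAlgClosure F) = e x)
    (heF : ∀ x : F, e (algebraMap F (CompletedAlgClosure F) x) = algebraMap F (CompletedAlgClosure F) (g x))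
    (Φp : BDeRhamPlus (integerC F) ℓ ≃+* BDeRhamPlus (integerC F) ℓ)
    (hΦp : ∀ x, Φp x = adicCompletionMap _ _ _ (map_ker_fontaineThetaInvertP_le ℓ f) x)
    (x : F) : Φp (embBdRHom hF hFF x) = embBdRHom hF hFF (g x) := by
  -- `g` fixes `ℚ_ℓ`
  have hgq : ∀ c : PadicBase F ℓ hF, g (algebraMap (PadicBase F ℓ hF) F c) = algebraMap (PadicBase F ℓ hF) F c := by
    intro c
    exact RingHom.congr_fun (LocalField.ringHom_padic_ext ((g : F →+* F).comp (LocalField.padicRingHom F ℓ hF))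
      (LocalField.padicRingHom F ℓ hF)) (PadicBase.toPadic hF c)
  -- agreement on `ℚ_ℓ`
  have h0 : ∀ c : PadicBase F ℓ hF, Φp (embBdRHom hF hFF (algebraMap (PadicBase F ℓ hF) F c)) =
      embBdRHom hF hFF (g (algebraMap (PadicBase F ℓ hF) F c)) := by
    intro c
    rw [embBdRHom_algebraMap, hΦp, bdRPlusMap_qpToBdR, hgq, embBdRHom_algebraMap]
  -- the two ring maps `F → B_dR⁺(F)`
  set ψ : F →+* BDeRhamPlus (integerC F) ℓ := (embBdRHom hF hFF).comp (g : F →+* F) with hψ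
  letI := baseAlgebraBdR (F := F) (p := ℓ) hF
  have hbase : Φp.toRingHom.comp (algebraMap (PadicBase F ℓ hF) (BDeRhamPlus (integerC F) ℓ)) =
      ψ.comp (algebraMap (PadicBase F ℓ hF) F) := by
    refine RingHom.ext fun c => ?_
    simp only [RingHom.coe_comp, Function.comp_apply, hψ, RingEquiv.coe_toRingHom]
    rw [← h0 c, embBdRHom_algebraMap, algebraMap_baseAlgebraBdR]
    rfl
  -- the minimal polynomial of the primitive element, pushed to `B_dR⁺(F)` along `Φp`
  set P : (BDeRhamPlus (integerC F) ℓ)[X] := (minpolyBdR hF).map Φp.toRingHom with hP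
  have hP' : P = (minpoly (PadicBase F ℓ hF) (basePowerBasis hF).gen).map (ψ.comp (algebraMap (PadicBase F ℓ hF) F)) := by
    rw [hP, minpolyBdR, Polynomial.map_map, hbase]
  -- its two roots
  have ha : P.eval (ψ (basePowerBasis hF).gen) = 0 := by
    rw [hP', eval_map, ← hom_eval₂, ← aeval_def, minpoly.aeval, map_zero]
  have ha' : P.eval (Φp (rootBdR hF hFF)) = 0 := by
    rw [hP, eval_map, show (Φp (rootBdR hF hFF)) = Φp.toRingHom (rootBdR hF hFF) from rfl, eval₂_hom, eval_rootBdR,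
      map_zero]
  -- with the same image under `θ`
  have hθψ : ∀ y : F, thetaBdR (ψ y) = algebraMap F (CompletedAlgClosure F) (g y) := fun y => thetaBdR_embBdRHom hF hFF _
  have hθ : thetaBdR (Φp (rootBdR hF hFF)) = thetaBdR (ψ (basePowerBasis hF).gen) := by
    rw [thetaBdR_ringEquiv_eq hF hF f e hfe Φp hΦp, thetaBdR_rootBdR, heF, hθψ]
  -- a simple root
  have hder : thetaBdR (P.derivative.eval (ψ (basePowerBasis hF).gen)) ≠ 0 := by
    rw [hP', derivative_map, eval_map, ← hom_eval₂, ← aeval_def, hθψ,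
      map_ne_zero_iff _ (algebraMap F (CompletedAlgClosure F)).injective, map_ne_zero_iff _ g.injective]
    exact (Algebra.IsSeparable.isSeparable (PadicBase F ℓ hF) (basePowerBasis hF).gen).aeval_derivative_ne_zero
      (minpoly.aeval _ _)
  have hroot : Φp (rootBdR hF hFF) = ψ (basePowerBasis hF).gen := root_unique hFF P ha ha' hθ hder
  -- conclude by the power basis
  have h : Φp.toRingHom.comp (embBdRHom hF hFF) = ψ := by
    refine ringHom_ext_powerBasis hF (basePowerBasis hF) _ _ (RingHom.ext fun c => ?_) ?_
    · simp only [RingHom.coe_comp, Function.comp_apply, hψ]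
      exact h0 c
    · rw [RingHom.comp_apply, embBdRHom_gen]
      exact hroot
  exact RingHom.congr_fun h x

/-- **`Φp` extends `ĝ` on Fontaine's section `ι_F : F̄ → B_dR⁺(F)`**: `Φp (ι_F x) = ι_F (ĝ x)` for a ring automorphism `ĝ` of `F̄`
restricting to `g` on `F`, when `Φp = B_dR⁺(f)` with `f = e|_{𝒪}` and `e|_{F̄} = ĝ`. Indeed `Φp (ι_F x)` reduces to `ĝ x` under `θ` and
is a root of `minpoly_F(x)` pushed along `g : F → F ⊆ B_dR⁺(F)`, which is `minpoly_F(ĝ x) · R` with `R(ĝ x) ≠ 0` (separability);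
uniqueness of Hensel lifts (`eq_liftElt`). [cite: FontaineAsterisque223III, Exp. II §1.5] [cite: BrinonConrad2009, Prop. 6.3.8] -/
theorem ringEquiv_algClosureToBdR_outer (hFF : Function.Surjective (fontaineTheta (integerC F) ℓ)) (g : F ≃+* F)
    (ĝ : AlgebraicClosure F ≃+* AlgebraicClosure F)
    (hĝ : ∀ c : F, ĝ (algebraMap F (AlgebraicClosure F) c) = algebraMap F (AlgebraicClosure F) (g c))
    (f : integerC F →+* integerC F) (e : CompletedAlgClosure F →+* CompletedAlgClosure F)
    (hfe : ∀ x : integerC F, ((f x : integerC F) : CompletedAlgClosure F) = e x)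
    (he : ∀ y : AlgebraicClosure F, e (algClosureToC F y) = algClosureToC F (ĝ y))
    (Φp : BDeRhamPlus (integerC F) ℓ ≃+* BDeRhamPlus (integerC F) ℓ)
    (hΦp : ∀ x, Φp x = adicCompletionMap _ _ _ (map_ker_fontaineThetaInvertP_le ℓ f) x)
    (x : AlgebraicClosure F) :
    Φp (algClosureToBdR hF hFF x) = algClosureToBdR hF hFF (ĝ x) := by
  -- `e` extends `g` on `F`
  have heF : ∀ y : F, e (algebraMap F (CompletedAlgClosure F) y) = algebraMap F (CompletedAlgClosure F) (g y) := by
    intro y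
    rw [← algClosureToC_algebraMap, he, hĝ, algClosureToC_algebraMap]
  set b := Φp (algClosureToBdR hF hFF x) with hb
  have hθ : thetaBdR b = algClosureToC F (ĝ x) := by
    rw [hb, thetaBdR_ringEquiv_eq hF hF f e hfe Φp hΦp, thetaBdR_algClosureToBdR, he]
  rw [algClosureToBdR_apply hF hFF (ĝ x)]
  refine eq_liftElt hF hFF ?_ hθ
  -- `b` is a root of `minpoly_F x` pushed along `g : F → F ⊆ B_dR⁺(F)`
  have h1 : (letI := bdRPlusAlgebraF hF hFF; aeval (algClosureToBdR hF hFF x) (minpoly F x)) = 0 := by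
    rw [algClosureToBdR_apply]; exact aeval_liftElt hF hFF x
  have h2 : (minpoly F x).eval₂ ((embBdRHom hF hFF).comp (g : F →+* F)) b = 0 := by
    letI := bdRPlusAlgebraF hF hFF
    have h := hom_eval₂ (minpoly F x) (algebraMap F (BDeRhamPlus (integerC F) ℓ)) Φp.toRingHom (algClosureToBdR hF hFF x)
    rw [← aeval_def, h1, map_zero] at h
    rw [hb, show Φp (algClosureToBdR hF hFF x) = Φp.toRingHom (algClosureToBdR hF hFF x) from rfl, h]
    congr 1
    refine RingHom.ext fun c => ?_
    simp only [RingHom.coe_comp, Function.comp_apply]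
    exact (ringEquiv_embBdRHom_outer hF hFF g f e hfe heF Φp hΦp c).symm
  -- as an `F`-polynomial identity in `B_dR⁺(F)`: `(minpoly_F x)^g` vanishes at `ĝ x`, so `minpoly_F (ĝ x)` divides it
  letI := bdRPlusAlgebraF hF hFF
  have hx0 : aeval (ĝ x) ((minpoly F x).map (g : F →+* F)) = 0 := by
    have h := hom_eval₂ (minpoly F x) (algebraMap F (AlgebraicClosure F)) (ĝ : AlgebraicClosure F →+* AlgebraicClosure F) x
    rw [← aeval_def, minpoly.aeval, map_zero] at h
    rw [aeval_def, eval₂_map, show ĝ x = (ĝ : AlgebraicClosure F →+* AlgebraicClosure F) x from rfl, h]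
    congr 1
    exact RingHom.ext fun c => (hĝ c).symm
  obtain ⟨R, hR⟩ := minpoly.dvd F (ĝ x) hx0
  have h3 : aeval b ((minpoly F x).map (g : F →+* F)) = 0 := by
    rw [aeval_def, eval₂_map]; exact h2
  rw [hR, map_mul] at h3
  -- `R(ĝ x) ≠ 0` by separability
  have hsep : ((minpoly F x).map (g : F →+* F)).Separable :=
    Polynomial.Separable.map (show (minpoly F x).Separable from Algebra.IsSeparable.isSeparable F x)
  have hR0 : aeval (ĝ x) R ≠ 0 := by
    intro h0
    refine hsep.aeval_derivative_ne_zero hx0 ?_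
    rw [hR, derivative_mul, map_add, map_mul, map_mul, h0, minpoly.aeval, mul_zero, zero_mul, add_zero]
  -- hence `R(b)` is a unit (its image under `θ` is `R(ĝ x)`)
  have hθR : thetaBdR (aeval b R) = algClosureToC F (aeval (ĝ x) R) := by
    calc thetaBdR (aeval b R) = thetaAlgHom hF hFF (aeval b R) := (thetaAlgHom_apply hF hFF _).symm
      _ = aeval (thetaAlgHom hF hFF b) R := (aeval_algHom_apply _ _ _).symm
      _ = aeval (algClosureToCAlgHom F (ĝ x)) R := by
          rw [thetaAlgHom_apply, hθ]; rfl
      _ = algClosureToCAlgHom F (aeval (ĝ x) R) := aeval_algHom_apply _ _ _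
      _ = algClosureToC F (aeval (ĝ x) R) := rfl
  have hunit : IsUnit (aeval b R) := by
    rw [isUnit_iff_thetaBdR_ne_zero hFF, hθR, map_ne_zero_iff _ (algClosureToC F).injective]
    exact hR0
  exact (hunit.mul_left_eq_zero).1 h3

end Pair

section OuterGalois

variable {K₀ : Type} [Field K₀] {F : Type} [Field F] [Algebra K₀ F] [ValuativeRel F] [TopologicalSpace F]
  [IsNonarchimedeanLocalField F] [CharZero F] {ℓ : ℕ} [Fact ℓ.Prime]
  [Fact (¬ IsUnit ((ℓ : ℕ) : integerC F))] [IsAdicComplete (Ideal.span {((ℓ : ℕ) : integerC F)}) (integerC F)]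
  (hF : valuation F (ℓ : F) < 1)
  (g : F ≃ₐ[K₀] F) (ĝ : AlgebraicClosure F ≃ₐ[K₀] AlgebraicClosure F)
  (hĝ : ∀ c : F, ĝ (algebraMap F (AlgebraicClosure F) c) = algebraMap F (AlgebraicClosure F) (g c))
  {α : absoluteGaloisGroup F ≃ₜ* absoluteGaloisGroup F}
  (hα : ∀ (σ : absoluteGaloisGroup F) (x : AlgebraicClosure F), α σ • ĝ x = ĝ (σ • x))

/-! ### §1 `ĝ` as an element of `Gal(F̄/ℚ_ℓ)`; the isometric extension to `ℂ_F` -/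

omit [Fact (¬ IsUnit ((ℓ : ℕ) : integerC F))] [IsAdicComplete (Ideal.span {((ℓ : ℕ) : integerC F)}) (integerC F)] in
/-- `g` fixes `ℚ_ℓ ⊆ F` (rigidity: any two ring maps `ℚ_ℓ → F` coincide, `LocalField.ringHom_padic_ext`).
[cite: SerreLocalFields1979, Ch. II §5] -/
theorem algEquiv_padicRingHom (q : ℚ_[ℓ]) : g (LocalField.padicRingHom F ℓ hF q) = LocalField.padicRingHom F ℓ hF q :=
  RingHom.congr_fun (LocalField.ringHom_padic_ext ((g : F →+* F).comp (LocalField.padicRingHom F ℓ hF))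
    (LocalField.padicRingHom F ℓ hF)) q

omit [Fact (¬ IsUnit ((ℓ : ℕ) : integerC F))] [IsAdicComplete (Ideal.span {((ℓ : ℕ) : integerC F)}) (integerC F)] in
include hF in
/-- **Automorphisms of an `ℓ`-adic field are isometries**: `‖g x‖ = ‖x‖` for the valuation norm of `F` — both `‖·‖` and `‖g ·‖`
are absolute values of the finite extension `F` of the complete field `ℚ_ℓ` extending `‖·‖_{ℚ_ℓ}` (`g` fixes `ℚ_ℓ`), hence both are
the spectral norm (Mathlib `spectralNorm_unique_field_norm_ext`). [cite: NeukirchANT1999, Ch. II (4.8)] -/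
theorem norm_algEquiv_eq (x : F) :
    letI := IsNonarchimedeanLocalField.nontriviallyNormedField F; ‖g x‖ = ‖x‖ := by
  letI := IsNonarchimedeanLocalField.nontriviallyNormedField F
  let f : AbsoluteValue F ℝ :=
    { toFun := fun y => ‖g y‖
      map_mul' := fun y z => by simp only [map_mul, norm_mul]
      nonneg' := fun y => norm_nonneg _
      eq_zero' := fun y => by simp only [norm_eq_zero, EmbeddingLike.map_eq_zero_iff]
      add_le' := fun y z => by simp only [map_add]; exact norm_add_le _ _ }
  let f₁ : AbsoluteValue F ℝ :=
    { toFun := fun y => ‖y‖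
      map_mul' := fun y z => norm_mul y z
      nonneg' := fun y => norm_nonneg _
      eq_zero' := fun y => norm_eq_zero
      add_le' := fun y z => norm_add_le _ _ }
  have h1 : ∀ c : PadicBase F ℓ hF, f (algebraMap (PadicBase F ℓ hF) F c) = ‖c‖ := by
    intro c
    change ‖g (algebraMap (PadicBase F ℓ hF) F c)‖ = ‖c‖
    rw [PadicBase.algebraMap_eq, PadicBase.emb_apply, algEquiv_padicRingHom hF g, ← PadicBase.emb_apply,
      ← PadicBase.algebraMap_eq, PadicBase.norm_algebraMap]
  have h2 : ∀ c : PadicBase F ℓ hF, f₁ (algebraMap (PadicBase F ℓ hF) F c) = ‖c‖ := fun c => PadicBase.norm_algebraMap hF c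
  exact (spectralNorm_unique_field_norm_ext h1 x).trans (spectralNorm_unique_field_norm_ext h2 x).symm

omit [Fact (¬ IsUnit ((ℓ : ℕ) : integerC F))] [IsAdicComplete (Ideal.span {((ℓ : ℕ) : integerC F)}) (integerC F)] in
include hF in
/-- **Automorphisms of an `ℓ`-adic field preserve the valuation**: `v(g x) = v(x)` (from `‖g x‖ = ‖x‖`, the norm being a strictly
monotone function of the valuation). [cite: NeukirchANT1999, Ch. II (4.8)] -/
theorem valuation_algEquiv_eq (x : F) : valuation F (g x) = valuation F x := by
  letI := IsTopologicalAddGroup.rightUniformSpace F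
  haveI := isUniformAddGroup_of_addCommGroup (G := F)
  letI := IsNonarchimedeanLocalField.rankOneValued F
  have h := norm_algEquiv_eq hF g x
  letI := IsNonarchimedeanLocalField.nontriviallyNormedField F
  refine le_antisymm ?_ ?_
  · have := h.le
    rwa [Valued.toNormedField.norm_le_iff] at this
  · have := h.ge
    rwa [Valued.toNormedField.norm_le_iff] at this

omit [Fact (¬ IsUnit ((ℓ : ℕ) : integerC F))] [IsAdicComplete (Ideal.span {((ℓ : ℕ) : integerC F)}) (integerC F)] in
include hĝ in
/-- **`ĝ` is an element of `G₀ = Gal(F̄/ℚ_ℓ)`** (`BaseGaloisGroup hF`): it fixes `ℚ_ℓ ⊆ F ⊆ F̄` since `g` does.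
[cite: Tate1967, §3.1] -/
theorem exists_baseGaloisGroup_outer :
    ∃ g₀ : BaseGaloisGroup hF, ∀ y : NormedAlgClosure F,
      g₀ • y = NormedAlgClosure.toAlgClosure.symm (ĝ (NormedAlgClosure.toAlgClosure y)) := by
  refine ⟨AlgEquiv.ofRingEquiv (f := (NormedAlgClosure.toAlgClosure (F := F)).toRingEquiv.trans
      (ĝ.toRingEquiv.trans (NormedAlgClosure.toAlgClosure (F := F)).symm.toRingEquiv)) (fun c => ?_), fun y => rfl⟩
  change NormedAlgClosure.toAlgClosure.symm (ĝ (NormedAlgClosure.toAlgClosure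
    (algebraMap (PadicBase F ℓ hF) (NormedAlgClosure F) c))) = _
  rw [PadicBase.algebraMap_closure_eq, PadicBase.algebraMap_eq, PadicBase.emb_apply, AlgEquiv.commutes, hĝ,
    algEquiv_padicRingHom hF g]
  rfl

omit [Fact (¬ IsUnit ((ℓ : ℕ) : integerC F))] [IsAdicComplete (Ideal.span {((ℓ : ℕ) : integerC F)}) (integerC F)] in
include hF hĝ hα in
/-- **`ĝ` extends to an isometric ring automorphism `e` of `ℂ_F` intertwining `Γ_F` with its outer conjugate**:
`‖e x‖ = ‖x‖`, `e|_{F̄} = ĝ`, `e (σ • x) = α σ • e x` (the action of `G₀ ∋ ĝ` on `ℂ_F`, `BaseGaloisAction`).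
[cite: Tate1967, §3.1] [cite: FontaineAsterisque223III, Exp. II §1.1–1.2] -/
theorem exists_completedAlgClosure_ringEquiv_outer :
    ∃ e : CompletedAlgClosure F ≃+* CompletedAlgClosure F,
      (∀ x, ‖e x‖ = ‖x‖) ∧
      (∀ y : AlgebraicClosure F, e (algClosureToC F y) = algClosureToC F (ĝ y)) ∧
      ∀ (σ : absoluteGaloisGroup F) (x : CompletedAlgClosure F), e (σ • x) = α σ • e x := by
  obtain ⟨g₀, hg₀⟩ := exists_baseGaloisGroup_outer hF g ĝ hĝ
  refine ⟨MulSemiringAction.toRingEquiv (BaseGaloisGroup hF) (CompletedAlgClosure F) g₀,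
    fun x => CompletedAlgClosure.norm_base_smul hF g₀ x, fun y => ?_, fun σ x => ?_⟩
  · change g₀ • algClosureToC F y = _
    rw [algClosureToC_apply, algClosureToC_apply, CompletedAlgClosure.base_smul_coe, hg₀]
    rfl
  · change g₀ • (σ • x) = α σ • (g₀ • x)
    -- `g₀ · toBase σ = toBase (α σ) · g₀` in `G₀` (both act on `F̄` as `y ↦ ĝ (σ y)`)
    have hcomm : g₀ * BaseGaloisGroup.toBase hF σ = BaseGaloisGroup.toBase hF (α σ) * g₀ := by
      refine AlgEquiv.ext fun y => ?_
      change g₀ • (BaseGaloisGroup.toBase hF σ • y) = BaseGaloisGroup.toBase hF (α σ) • (g₀ • y)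
      rw [BaseGaloisGroup.toBase_smul, BaseGaloisGroup.toBase_smul, hg₀, hg₀, NormedAlgClosure.toAlgClosure_smul,
        ← hα]
      rfl
    rw [← CompletedAlgClosure.toBase_smul_completion hF σ, ← CompletedAlgClosure.toBase_smul_completion hF (α σ),
      ← mul_smul, hcomm, mul_smul]

/-! ### §4 Assembly -/

variable [IsDomain (BDeRhamPlus (integerC F) ℓ)]

include hĝ hα in
/-- ★ **`B_dR(F) ≃ B_dR(F)` along the outer Galois automorphism `ĝ`, with all its compatibilities.** There is a ring
automorphism `Φ` of `B_dR(F) = Frac B_dR⁺(F)` which (1) intertwines `Γ_F` with its outer conjugate: `Φ (σ • b) = α σ • Φ b`;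
(2) is the identity on `ℚ_ℓ ⊆ B_dR⁺`; (3) extends `ĝ` along Fontaine's section `ι_F : F̄ ⊆ B_dR⁺(F)` (`Φ (ι_F x) = ι_F (ĝ x)`);
(4) extends `g` on `F ⊆ B_dR(F)`; (5) is strictly compatible with the filtration: `b ∈ Fil^i ↔ Φ b ∈ Fil^i`.
`Φ = Frac B_dR⁺(f)` for the restriction `f : 𝒪_{ℂ_F} ≃ 𝒪_{ℂ_F}` of the isometric extension `e` of `ĝ` to `ℂ_F` (§1); (1)–(2) by the
functoriality of `B_dR⁺` (`BdRBaseChange`), (3)–(5) by §3 and `BdRBaseChangeFiltered`.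
[cite: BrinonConrad2009, Prop. 6.3.8] [cite: FontaineAsterisque223III, Exp. II §1.5] -/
theorem exists_fracBdR_ringEquiv_outer (hFF : Function.Surjective (fontaineTheta (integerC F) ℓ)) :
    ∃ Φ : FracBdR F ℓ ≃+* FracBdR F ℓ,
      (∀ (σ : absoluteGaloisGroup F) (b : FracBdR F ℓ), Φ (σ • b) = α σ • Φ b) ∧
      (∀ q : ℚ_[ℓ], Φ (algebraMap (BDeRhamPlus (integerC F) ℓ) (FracBdR F ℓ) (qpToBdR q)) =
        algebraMap (BDeRhamPlus (integerC F) ℓ) (FracBdR F ℓ) (qpToBdR q)) ∧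
      (∀ x : AlgebraicClosure F,
        Φ (algebraMap (BDeRhamPlus (integerC F) ℓ) (FracBdR F ℓ) (algClosureToBdR hF hFF x)) =
          algebraMap (BDeRhamPlus (integerC F) ℓ) (FracBdR F ℓ) (algClosureToBdR hF hFF (ĝ x))) ∧
      (∀ x : F, Φ (algebraMap (BDeRhamPlus (integerC F) ℓ) (FracBdR F ℓ) (embBdRHom hF hFF x)) =
        algebraMap (BDeRhamPlus (integerC F) ℓ) (FracBdR F ℓ) (embBdRHom hF hFF (g x))) ∧
      ∀ (i : ℤ) (b : FracBdR F ℓ), (letI := fracAlgebra (p := ℓ) hF hFF; b ∈ fil hF hFF i) ↔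
        letI := fracAlgebra (p := ℓ) hF hFF; Φ b ∈ fil hF hFF i := by
  obtain ⟨e, he_norm, he, he_smul⟩ := exists_completedAlgClosure_ringEquiv_outer hF g ĝ hĝ hα
  -- `f : 𝒪_{ℂ_F} ≃ 𝒪_{ℂ_F}`, the restriction of `e` to the unit ball
  have hmem : ∀ x : CompletedAlgClosure F, x ∈ integerC F ↔ e x ∈ integerC F := fun x => by
    rw [mem_integerC_iff, mem_integerC_iff, he_norm]
  obtain ⟨f, hf⟩ : ∃ f : integerC F ≃+* integerC F, ∀ x : integerC F, ((f x : integerC F) : CompletedAlgClosure F) = e x :=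
    ⟨{ (e.toEquiv.subtypeEquiv hmem : integerC F ≃ integerC F) with
        map_mul' := fun x y => Subtype.ext (map_mul e (x : CompletedAlgClosure F) (y : CompletedAlgClosure F))
        map_add' := fun x y => Subtype.ext (map_add e (x : CompletedAlgClosure F) (y : CompletedAlgClosure F)) },
      fun _ => rfl⟩
  have hgal : ∀ (σ : absoluteGaloisGroup F) (x : integerC F), f (galInt σ x) = galInt (α σ) (f x) := fun σ x =>
    Subtype.ext (by rw [hf, coe_galInt, coe_galInt, hf, he_smul])
  have hfe : ∀ x : integerC F, ((f.toRingHom x : integerC F) : CompletedAlgClosure F) = e x := hf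
  -- `Φp = B_dR⁺(f)`, an isomorphism with inverse `B_dR⁺(f⁻¹)`
  obtain ⟨Φp, hΦp⟩ : ∃ Φp : BDeRhamPlus (integerC F) ℓ ≃+* BDeRhamPlus (integerC F) ℓ,
      ∀ x, Φp x = adicCompletionMap _ _ _ (map_ker_fontaineThetaInvertP_le ℓ f.toRingHom) x :=
    ⟨RingEquiv.ofRingHom (adicCompletionMap _ _ _ (map_ker_fontaineThetaInvertP_le ℓ f.toRingHom))
        (adicCompletionMap _ _ _ (map_ker_fontaineThetaInvertP_le ℓ f.symm.toRingHom))
        (bdRPlusMap_comp_eq_id (RingEquiv.toRingHom_comp_symm_toRingHom f))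
        (bdRPlusMap_comp_eq_id (RingEquiv.symm_toRingHom_comp_toRingHom f)),
      fun _ => rfl⟩
  have hgalp : ∀ (σ : absoluteGaloisGroup F) (b : BDeRhamPlus (integerC F) ℓ),
      Φp (galBdRPlus σ b) = galBdRPlus (α σ) (Φp b) := fun σ b =>
    (hΦp _).trans ((bdRPlusMap_galBdRPlus_pair f.toRingHom σ (α σ) (fun x => hgal σ x) b).trans
      (congrArg (galBdRPlus (α σ)) (hΦp b).symm))
  have hqp : ∀ q : ℚ_[ℓ], Φp (qpToBdR q) = qpToBdR q := fun q => (hΦp _).trans (bdRPlusMap_qpToBdR f.toRingHom q)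
  -- `Φ = Frac Φp`
  obtain ⟨Φ, hΦ⟩ : ∃ Φ : FracBdR F ℓ ≃+* FracBdR F ℓ, ∀ x,
      Φ (algebraMap (BDeRhamPlus (integerC F) ℓ) (FracBdR F ℓ) x) =
        algebraMap (BDeRhamPlus (integerC F) ℓ) (FracBdR F ℓ) (Φp x) :=
    ⟨IsFractionRing.ringEquivOfRingEquiv Φp, IsFractionRing.ringEquivOfRingEquiv_algebraMap Φp⟩
  refine ⟨Φ, fun σ b => ?_, fun q => (hΦ _).trans (congrArg (algebraMap _ (FracBdR F ℓ)) (hqp q)), fun x => ?_, fun x => ?_,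
    fun i b => mem_fil_iff_ringEquiv_mem_fil hF hF hFF hFF Φp Φ hΦ i b⟩
  · have h : Φ.toRingHom.comp (MulSemiringAction.toRingHom (absoluteGaloisGroup F) (FracBdR F ℓ) σ) =
        (MulSemiringAction.toRingHom (absoluteGaloisGroup F) (FracBdR F ℓ) (α σ)).comp Φ.toRingHom :=
      IsLocalization.ringHom_ext (nonZeroDivisors (BDeRhamPlus (integerC F) ℓ)) (RingHom.ext fun x =>
        show Φ (σ • algebraMap _ (FracBdR F ℓ) x) = α σ • Φ (algebraMap _ (FracBdR F ℓ) x) from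
          (congrArg Φ (smul_algebraMap_fracBdR _ x)).trans <| (hΦ _).trans <|
            (congrArg (algebraMap _ (FracBdR F ℓ)) (hgalp σ x)).trans <|
              (smul_algebraMap_fracBdR (α σ) (Φp x)).symm.trans (congrArg (α σ • ·) (hΦ x).symm))
    exact RingHom.congr_fun h b
  · rw [hΦ, ringEquiv_algClosureToBdR_outer hF hFF g.toRingEquiv ĝ.toRingEquiv hĝ f.toRingHom e.toRingHom hfe he Φp hΦp x]
    rfl
  · have heF : ∀ y : F, e (algebraMap F (CompletedAlgClosure F) y) = algebraMap F (CompletedAlgClosure F) (g y) := by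
      intro y
      rw [← algClosureToC_algebraMap, he, hĝ, algClosureToC_algebraMap]
    rw [hΦ, ringEquiv_embBdRHom_outer hF hFF g.toRingEquiv f.toRingHom e.toRingHom hfe heF Φp hΦp x]
    rfl

end OuterGalois

end Literature.NumberTheory.PAdicHodge

end
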